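import Literature.NumberTheory.GaloisRepresentations.RamificationCertificatesProofs
import HarnessLib

/-!
# Valuation certificates for the `2`-adic congruence classes of `j ≠ 0, 1728`

`Proofs` file (theorems only, no definitions, no named facts) in topic
`NumberTheory/EllipticCurves`, landed by the seat of bsd.S15
(`Literature.NumberTheory.EllipticCurves.conductorNorm_eq_artinConductorNat_of_isElliptic`): the
elementary valuation lemmas through which the per-`(c₄, c₆)`-class files turn computer-found
polynomial identities in `S_E = integralClosure ℤ K(x(E[3]))` into the `𝔓_E`-orders consumed by
`ThreeTorsionInertiaStructureProofs` and `ThreeTorsionFakePointProductsProofs` (Ogg's formula at `2`,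
Galois side).  Setting: a Dedekind domain `B`, a prime `𝔓 ≠ 0`, the element `2 ∈ 𝔓` with
`v(2) = o ∈ (0, ∞)`, a cube root `δ₁` (`δ₁³ = 2ʳ D`, `D` a unit) and `ζ = ζ₃`:

* `ord_mul_of_notMem`, `ord_two_pow_mul` — bookkeeping;
* `intCast_add_intCast_mul_notMem_of_odd` — `a + bζ` is a unit at `𝔓 ∋ 2` when `a` or `b` is odd
  (`𝔽₂(ζ̄) = 𝔽₄`);
* `three_mul_ord_eq_of_cube_eq` — `3 v(δ₁) = r v(2)`;
* `three_mul_ord_eq_of_dominant` — **dominant term, `e₀ = 3`**: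
  `3 v(2^{a₀}Uδ₁^{j₀} + 2^{a₁}V₁δ₁^{j₁} + 2^{a₂}V₂δ₁^{j₂}) = (3a₀ + r j₀) v(2)` for a unit `U` and
  `3aᵢ + r jᵢ > 3a₀ + r j₀`;
* `ord_eq_of_dominant` — **dominant term, `e₀ = 1`**: `v(2^ν U + 2^{b₁}V₁w + 2^{b₂}V₂w²) = ν v(2)`
  for a unit `U`, `v(w) ≥ 3v(2)` and `bₖ + 3k ≥ ν + 1`;
* `exists_pow_mul_sub_intCast_mem` — **choice of the cube root by its residue**: if `δ₁³ = D`,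
  `D - d₀³ ∈ 8B`, `d₀` odd, `3 ∉ 𝔓`, then some `ζⁱδ₁` has `ζⁱδ₁ - d₀ ∈ 𝔓` and
  `v(ζⁱδ₁ - d₀) ≥ 3 v(2)`.

## References
* J.-P. Serre, *Local Fields*, GTM 67, Springer 1979, Ch. I §3 (valuations of a Dedekind domain),
  Ch. II §3 (`v(x + y) = min` for `v(x) ≠ v(y)`). [cite: SerreLocalFields1979, Ch. I §3]
-/

noncomputable section

open scoped Classical

namespace Literature.NumberTheory.EllipticCurves

open Literature.NumberTheory.GaloisRepresentations

variable {B : Type*} [CommRing B] [IsDedekindDomain B] (P : Ideal B) [P.IsPrime]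

/-- A unit times an element: `v(u x) = v(x)` for `u ∉ 𝔓`. [folklore] -/
theorem ord_mul_of_notMem (hP : P ≠ ⊥) {u : B} (hu : u ∉ P) (x : B) : ord P (u * x) = ord P x := by
  rw [ord_mul P hP, (ord_eq_zero_iff P).mpr hu, zero_add]

/-- `v(2ᵃ x) = a v(2) + v(x)`. [folklore] -/
theorem ord_two_pow_mul (hP : P ≠ ⊥) (a : ℕ) (x : B) :
    ord P (2 ^ a * x) = a * ord P (2 : B) + ord P x := by
  rw [ord_mul P hP, ord_pow P hP]

omit [IsDedekindDomain B] in
/-- **Units `a + bζ₃` at a prime above `2`**: if `ζ² + ζ + 1 = 0`, `2 ∈ 𝔓 ≠ ⊤`, and `a` or `b` is odd,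
then `a + bζ ∉ 𝔓` (the residue field contains `𝔽₄ = 𝔽₂(ζ̄)`; `ζ³ = 1`, `1 + ζ = -ζ²`). [folklore] -/
theorem intCast_add_intCast_mul_notMem_of_odd {ζ : B} (hζ : ζ ^ 2 + ζ + 1 = 0) (h2 : (2 : B) ∈ P)
    (hP1 : P ≠ ⊤) {a b : ℤ} (hab : Odd a ∨ Odd b) : (a : B) + b * ζ ∉ P := by
  have hζ3 : ζ ^ 3 = 1 := by linear_combination (ζ - 1) * hζ
  have h1 : (1 : B) ∉ P := fun h => hP1 ((Ideal.eq_top_iff_one _).mpr h)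
  have hζu : ζ ∉ P := by
    intro h
    apply h1
    rw [← hζ3, pow_succ]
    exact Ideal.mul_mem_left _ _ h
  have hζ1u : 1 + ζ ∉ P := by
    intro h
    have : ζ ^ 2 = -(1 + ζ) := by linear_combination hζ
    have hsq : ζ ^ 2 ∈ P := by rw [this]; exact neg_mem h
    exact hζu (Ideal.IsPrime.mem_of_pow_mem inferInstance 2 hsq)
  -- reduce `a, b` modulo `2`
  obtain ⟨a', ra, hra, ha⟩ : ∃ a' : ℤ, ∃ ra : ℤ, (ra = 0 ∨ ra = 1) ∧ a = 2 * a' + ra :=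
    ⟨a / 2, a % 2, by omega, by omega⟩
  obtain ⟨b', rb, hrb, hb⟩ : ∃ b' : ℤ, ∃ rb : ℤ, (rb = 0 ∨ rb = 1) ∧ b = 2 * b' + rb :=
    ⟨b / 2, b % 2, by omega, by omega⟩
  intro hmem
  have hred : (ra : B) + rb * ζ ∈ P := by
    have e : (ra : B) + rb * ζ = ((a : B) + b * ζ) - 2 * ((a' : B) + b' * ζ) := by
      rw [ha, hb]; push_cast; ring
    rw [e]
    exact Ideal.sub_mem _ hmem (Ideal.mul_mem_right _ _ h2)
  rcases hra with rfl | rfl <;> rcases hrb with rfl | rfl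
  · -- both even: contradicts `hab`
    rcases hab with ⟨k, hk⟩ | ⟨k, hk⟩ <;> omega
  · simp only [Int.cast_zero, Int.cast_one, zero_add, one_mul] at hred
    exact hζu hred
  · simp only [Int.cast_zero, Int.cast_one, zero_mul, add_zero] at hred
    exact h1 hred
  · simp only [Int.cast_one, one_mul] at hred
    exact hζ1u hred

/-- **`3 v(δ₁) = r v(2)`** for `δ₁³ = 2ʳ D` with `D ∉ 𝔓`. [folklore] -/
theorem three_mul_ord_eq_of_cube_eq (hP : P ≠ ⊥) {δ₁ D : B} {r : ℕ} (hδ : δ₁ ^ 3 = 2 ^ r * D)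
    (hD : D ∉ P) : 3 * ord P δ₁ = r * ord P (2 : B) := by
  have h := congrArg (ord P) hδ
  rw [ord_pow P hP, ord_mul P hP, ord_pow P hP, (ord_eq_zero_iff P).mpr hD, add_zero] at h
  exact_mod_cast h

/-- **Dominant term, ramified cube root** (`e₀ = 3`): if `3 v(δ₁) = r v(2)` with `r ∈ {1, 2}`,
`v(2) ∈ (0, ∞)`, `U ∉ 𝔓`, and `3aᵢ + r jᵢ > 3a₀ + r j₀` (`i = 1, 2`), then
`3 · v(2^{a₀} U δ₁^{j₀} + 2^{a₁} V₁ δ₁^{j₁} + 2^{a₂} V₂ δ₁^{j₂}) = (3a₀ + r j₀) · v(2)`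
(the three terms have distinct orders; isosceles). [folklore] -/
theorem three_mul_ord_eq_of_dominant (hP : P ≠ ⊥) {o : ℕ} (ho : ord P (2 : B) = o) (hopos : 0 < o)
    {δ₁ : B} {r : ℕ} (hδ : 3 * ord P δ₁ = r * ord P (2 : B))
    {U : B} (hU : U ∉ P) (V₁ V₂ : B) {a₀ j₀ a₁ j₁ a₂ j₂ : ℕ}
    (h₁ : 3 * a₀ + r * j₀ < 3 * a₁ + r * j₁) (h₂ : 3 * a₀ + r * j₀ < 3 * a₂ + r * j₂) :
    3 * ord P (2 ^ a₀ * U * δ₁ ^ j₀ + 2 ^ a₁ * V₁ * δ₁ ^ j₁ + 2 ^ a₂ * V₂ * δ₁ ^ j₂) =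
      (3 * a₀ + r * j₀ : ℕ) * ord P (2 : B) := by
  -- `d = v(δ₁)` is finite with `3 d = r o`
  have hdfin : ord P δ₁ ≠ ⊤ := by
    intro h
    rw [h, ho, ENat.mul_top (by norm_num), ← Nat.cast_mul] at hδ
    exact ENat.top_ne_coe _ hδ
  obtain ⟨d, hd⟩ := ENat.ne_top_iff_exists.mp hdfin
  rw [← hd, ho] at hδ
  have hd3 : 3 * d = r * o := by exact_mod_cast hδ
  -- orders of the three terms
  have hlead : ord P (2 ^ a₀ * U * δ₁ ^ j₀) = ((a₀ * o + j₀ * d : ℕ) : ℕ∞) := by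
    rw [ord_mul P hP, ord_mul P hP, ord_pow P hP, ord_pow P hP, (ord_eq_zero_iff P).mpr hU, ho, ← hd]
    push_cast; ring
  have hge : ∀ (a j : ℕ) (V : B), ((a * o + j * d : ℕ) : ℕ∞) ≤ ord P (2 ^ a * V * δ₁ ^ j) := by
    intro a j V
    rw [ord_mul P hP, ord_mul P hP, ord_pow P hP, ord_pow P hP, ho, ← hd]
    have h0 : (0 : ℕ∞) ≤ ord P V := bot_le
    calc ((a * o + j * d : ℕ) : ℕ∞) = (a : ℕ∞) * o + 0 + j * d := by push_cast; ring
      _ ≤ (a : ℕ∞) * o + ord P V + j * d := by gcongr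
  have hlt : ∀ (a j : ℕ) (V : B), 3 * a₀ + r * j₀ < 3 * a + r * j →
      ord P (2 ^ a₀ * U * δ₁ ^ j₀) < ord P (2 ^ a * V * δ₁ ^ j) := by
    intro a j V h
    refine lt_of_lt_of_le ?_ (hge a j V)
    rw [hlead]
    have : a₀ * o + j₀ * d < a * o + j * d := by nlinarith
    exact_mod_cast this
  have e1 : ord P (2 ^ a₀ * U * δ₁ ^ j₀ + 2 ^ a₁ * V₁ * δ₁ ^ j₁) = ord P (2 ^ a₀ * U * δ₁ ^ j₀) := by
    rw [add_comm]; exact ord_add_eq_of_lt P (hlt a₁ j₁ V₁ h₁)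
  have hsum : ord P (2 ^ a₀ * U * δ₁ ^ j₀ + 2 ^ a₁ * V₁ * δ₁ ^ j₁ + 2 ^ a₂ * V₂ * δ₁ ^ j₂) =
      ord P (2 ^ a₀ * U * δ₁ ^ j₀) := by
    rw [add_comm (2 ^ a₀ * U * δ₁ ^ j₀ + 2 ^ a₁ * V₁ * δ₁ ^ j₁), ← e1]
    exact ord_add_eq_of_lt P (by rw [e1]; exact hlt a₂ j₂ V₂ h₂)
  rw [hsum, hlead, ho]
  have : 3 * (a₀ * o + j₀ * d) = (3 * a₀ + r * j₀) * o := by nlinarith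
  exact_mod_cast congrArg (fun n : ℕ => (n : ℕ∞)) this

/-- **Dominant term, unit cube root** (`e₀ = 1`): if `v(w) ≥ 3 v(2)` (`w = δ₁ - d₀`), `U ∉ 𝔓`, and
`bₖ + 3k ≥ ν + 1` (`k = 1, 2`), then `v(2^ν U + 2^{b₁} V₁ w + 2^{b₂} V₂ w²) = ν v(2)`. [folklore] -/
theorem ord_eq_of_dominant (hP : P ≠ ⊥) {o : ℕ} (ho : ord P (2 : B) = o) (hopos : 0 < o)
    {w : B} (hw : ((3 * o : ℕ) : ℕ∞) ≤ ord P w) {U : B} (hU : U ∉ P) (V₁ V₂ : B) {ν b₁ b₂ : ℕ}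
    (h₁ : ν + 1 ≤ b₁ + 3) (h₂ : ν + 1 ≤ b₂ + 6) :
    ord P (2 ^ ν * U + 2 ^ b₁ * V₁ * w + 2 ^ b₂ * V₂ * w ^ 2) = (ν : ℕ∞) * ord P (2 : B) := by
  have hlead : ord P (2 ^ ν * U) = ((ν * o : ℕ) : ℕ∞) := by
    rw [ord_mul P hP, ord_pow P hP, (ord_eq_zero_iff P).mpr hU, ho]; push_cast; ring
  have hge : ∀ (b k : ℕ) (V : B), ν + 1 ≤ b + 3 * k → (((ν + 1) * o : ℕ) : ℕ∞) ≤ ord P (2 ^ b * V * w ^ k) := by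
    intro b k V h
    rw [ord_mul P hP, ord_mul P hP, ord_pow P hP, ord_pow P hP, ho]
    have h0 : (0 : ℕ∞) ≤ ord P V := bot_le
    have hwk : ((3 * o * k : ℕ) : ℕ∞) ≤ (k : ℕ∞) * ord P w := by
      calc ((3 * o * k : ℕ) : ℕ∞) = (k : ℕ∞) * ((3 * o : ℕ) : ℕ∞) := by push_cast; ring
        _ ≤ (k : ℕ∞) * ord P w := by gcongr
    calc (((ν + 1) * o : ℕ) : ℕ∞) ≤ ((b * o + 0 + 3 * o * k : ℕ) : ℕ∞) := by exact_mod_cast (by nlinarith)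
      _ = (b : ℕ∞) * o + 0 + ((3 * o * k : ℕ) : ℕ∞) := by push_cast; ring
      _ ≤ (b : ℕ∞) * o + ord P V + (k : ℕ∞) * ord P w := by gcongr
  have hlt : ∀ (b k : ℕ) (V : B), ν + 1 ≤ b + 3 * k → ord P (2 ^ ν * U) < ord P (2 ^ b * V * w ^ k) := by
    intro b k V h
    refine lt_of_lt_of_le ?_ (hge b k V h)
    rw [hlead]
    exact_mod_cast (by nlinarith : ν * o < (ν + 1) * o)
  have e1 : ord P (2 ^ ν * U + 2 ^ b₁ * V₁ * w) = ord P (2 ^ ν * U) := by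
    rw [add_comm, show (2 : B) ^ b₁ * V₁ * w = 2 ^ b₁ * V₁ * w ^ 1 by rw [pow_one]]
    exact ord_add_eq_of_lt P (hlt b₁ 1 V₁ (by omega))
  rw [add_comm, ord_add_eq_of_lt P (by rw [e1]; exact hlt b₂ 2 V₂ (by omega)), e1, hlead, ho]
  push_cast; ring

/-- **Choosing the cube root by its residue**: if `ζ² + ζ + 1 = 0`, `δ₁³ = D` with `D - d₀³ = 8m`
(`d₀` odd), `2 ∈ 𝔓`, `3 ∉ 𝔓`, then for some `i < 3`, `ζⁱδ₁ ≡ d₀ (mod 𝔓)` and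
`v(ζⁱδ₁ - d₀) ≥ 3 v(2)` (`∏ᵢ (ζⁱδ₁ - d₀) = D - d₀³`, the other two factors being units). [folklore] -/
theorem exists_pow_mul_sub_intCast_mem (hP : P ≠ ⊥) (hP1 : P ≠ ⊤) {ζ δ₁ D m : B}
    (hζ : ζ ^ 2 + ζ + 1 = 0) (hδ : δ₁ ^ 3 = D) {d₀ : ℤ} (hd₀ : Odd d₀) (hm : D - (d₀ : B) ^ 3 = 8 * m)
    (h2 : (2 : B) ∈ P) (h3 : (3 : B) ∉ P) :
    ∃ i : ℕ, i < 3 ∧ ζ ^ i * δ₁ - d₀ ∈ P ∧ ((3 : ℕ) : ℕ∞) * ord P (2 : B) ≤ ord P (ζ ^ i * δ₁ - d₀) := by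
  have hζ3 : ζ ^ 3 = 1 := by linear_combination (ζ - 1) * hζ
  have h1 : (1 : B) ∉ P := fun h => hP1 ((Ideal.eq_top_iff_one _).mpr h)
  have hζu : ζ ∉ P := by
    intro h; apply h1; rw [← hζ3, pow_succ]; exact Ideal.mul_mem_left _ _ h
  -- `ζ - 1` and `d₀` are units
  have hζm1 : ζ - 1 ∉ P := by
    intro h
    have hsq : (ζ - 1) * (ζ - 1) = -(3 * ζ) := by linear_combination hζ
    have := Ideal.mul_mem_left _ (ζ - 1) h
    rw [hsq] at this
    rcases (Ideal.IsPrime.mem_or_mem inferInstance (neg_mem_iff.mp this)) with h' | h'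
    · exact h3 h'
    · exact hζu h'
  have hd₀u : (d₀ : B) ∉ P := by
    have := intCast_add_intCast_mul_notMem_of_odd P hζ h2 hP1 (a := d₀) (b := 0) (Or.inl hd₀)
    simpa using this
  -- the product of the three candidates
  have hprod : (δ₁ - d₀) * (ζ * δ₁ - d₀) * (ζ ^ 2 * δ₁ - d₀) = 8 * m := by
    rw [← hm, ← hδ]
    linear_combination ((ζ - 1) * δ₁ ^ 3 - (d₀ : B) * ζ * δ₁ ^ 2 + (d₀ : B) ^ 2 * δ₁) * hζ
  have h8 : (8 : B) * m ∈ P := by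
    rw [show (8 : B) = 2 * 4 by norm_num, mul_assoc]
    exact Ideal.mul_mem_right _ _ h2
  -- if `ζ^i δ₁ - d₀ ∈ P` then the next one is a unit
  have hnext : ∀ x : B, x - d₀ ∈ P → ζ * x - d₀ ∉ P := by
    intro x hx hmem
    have e : ζ * x - d₀ = ζ * (x - d₀) + (ζ - 1) * d₀ := by ring
    rw [e] at hmem
    have : (ζ - 1) * (d₀ : B) ∈ P := by
      have := Ideal.sub_mem _ hmem (Ideal.mul_mem_left _ ζ hx)
      simpa using this
    rcases (Ideal.IsPrime.mem_or_mem inferInstance this) with h' | h'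
    · exact hζm1 h'
    · exact hd₀u h'
  -- orders: the product has order `≥ 3 v(2)`, units contribute `0`
  have hord8 : ((3 : ℕ) : ℕ∞) * ord P (2 : B) ≤ ord P (8 * m) := by
    rw [show (8 : B) = 2 ^ 3 by norm_num, ord_mul P hP, ord_pow P hP]
    push_cast
    exact le_self_add
  rw [← hprod] at h8 hord8
  have hu : ∀ x : B, ζ * x - d₀ ∈ P → x - d₀ ∉ P := fun x hx h => hnext x h hx
  have hζ2δ : ζ * (ζ * δ₁) = ζ ^ 2 * δ₁ := by ring
  have hζ3δ : ζ * (ζ ^ 2 * δ₁) = δ₁ := by rw [← mul_assoc, ← pow_succ', hζ3, one_mul]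
  have hsplit : ord P ((δ₁ - d₀) * (ζ * δ₁ - d₀) * (ζ ^ 2 * δ₁ - d₀)) =
      ord P (δ₁ - d₀) + ord P (ζ * δ₁ - d₀) + ord P (ζ ^ 2 * δ₁ - d₀) := by
    rw [ord_mul P hP, ord_mul P hP]
  rcases (Ideal.IsPrime.mem_or_mem inferInstance h8) with h12 | h3c
  · rcases (Ideal.IsPrime.mem_or_mem inferInstance h12) with h0 | h1c
    · -- `i = 0`
      have u1 : ζ * δ₁ - d₀ ∉ P := hnext δ₁ h0
      have u2 : ζ ^ 2 * δ₁ - d₀ ∉ P := fun h => by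
        have := hnext (ζ ^ 2 * δ₁) h
        rw [hζ3δ] at this
        exact this h0
      refine ⟨0, by norm_num, by simpa using h0, ?_⟩
      rw [hsplit, (ord_eq_zero_iff P).mpr u1, (ord_eq_zero_iff P).mpr u2, add_zero, add_zero] at hord8
      simpa using hord8
    · -- `i = 1`
      have u0 : δ₁ - d₀ ∉ P := hu δ₁ h1c
      have u2 : ζ ^ 2 * δ₁ - d₀ ∉ P := by
        have := hnext (ζ * δ₁) h1c
        rwa [hζ2δ] at this
      refine ⟨1, by norm_num, by simpa using h1c, ?_⟩
      rw [hsplit, (ord_eq_zero_iff P).mpr u0, (ord_eq_zero_iff P).mpr u2, zero_add, add_zero] at hord8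
      simpa using hord8
  · -- `i = 2`
    have u0 : δ₁ - d₀ ∉ P := by
      have := hnext (ζ ^ 2 * δ₁) h3c
      rwa [hζ3δ] at this
    have u1 : ζ * δ₁ - d₀ ∉ P := fun h => by
      have := hnext (ζ * δ₁) h
      rw [hζ2δ] at this
      exact this h3c
    refine ⟨2, by norm_num, h3c, ?_⟩
    rw [hsplit, (ord_eq_zero_iff P).mpr u0, (ord_eq_zero_iff P).mpr u1, zero_add, zero_add] at hord8
    exact hord8

end Literature.NumberTheory.EllipticCurves

end
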